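import Literature.Computability.AlgebraicComplexity.MatMulTwoTwoNRankUpper
import Literature.Computability.AlgebraicComplexity.SmallFormatMatMulRankUpper
import Literature.Computability.AlgebraicComplexity.LafonWinogradRankBound
import HarnessLib

/-!
# Hopcroft–Kerr's `R(⟨3,2,n⟩) ≤ 5n` (`n ≥ 3`) and the sandwiches `3n+1 ≤ R(⟨2,2,n⟩) ≤ ⌈7n/2⌉`,
`4n+2 ≤ R(⟨2,3,n⟩) ≤ 5n` over every field

Topic `Literature/Computability/AlgebraicComplexity` (bilinear complexity; small formats). Everything
here is PROVED; no named facts.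

* **Hopcroft–Kerr 1971** ("an algorithm to multiply a `p × 2` matrix by a `2 × n` matrix in
  `⌈(3pn + max(n,p))/2⌉` multiplications without use of commutativity", abstract and §2): at `p = 3`
  and `n ≥ 3` the count is `⌈(9n + n)/2⌉ = 5n`. We prove `R(⟨2,3,n⟩) ≤ 5n` for all `n ≥ 3` over
  every commutative ring (`hopcroftKerr1971_tensorRank_matMulTensor_23n_le`; the format of the
  printed statement, `3 × 2` by `2 × n`, is `hopcroftKerr1971_tensorRank_matMulTensor_32n_le`, same
  number by `R(⟨k,m,n⟩) = R(⟨n,m,k⟩) = R(⟨m,n,k⟩)`), by gluing along the free dimension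
  (`tensorRank_matMulTensor_add_right_le`, `MatMulTwoTwoNRankUpper.lean`) the tree's kernel-checked
  Hopcroft–Kerr schemes `⟨2,3,3⟩:15`, `⟨2,3,4⟩:20`, `⟨2,3,5⟩:25` (`SmallFormatMatMulRankUpper.lean`):
  `n = 3j + 3 + r`, `r < 3`. (This is a re-assembly of HK's count from its three smallest instances,
  not HK's uniform construction; the bound is the printed one.)
* **Lower companions over every field** (Lafon–Winograd / Bürgisser–Clausen–Shokrollahi 1997
  Thm. (17.12), tree `lafonWinograd_le_tensorRank_matMulTensor`; for these 2-row formats the same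
  numbers are Bläser 2003 eq. (1), e.g. "the lower bound `3m + 1`" for `⟨m,2,2⟩` credited to
  Bläser 2003 by Alekseev 2015, §1): `3n + 1 ≤ R(⟨2,2,n⟩)` and `4n + 2 ≤ R(⟨2,3,n⟩)` (`n ≥ 1`).
  Hence over every field: `3n+1 ≤ R(⟨2,2,n⟩) ≤ ⌈7n/2⌉` (all `n ≥ 1`) and
  `4n+2 ≤ R(⟨2,3,n⟩) ≤ 5n` (`n ≥ 3`).

Status in print of sharper bounds (NOT proved here): `R(⟨m,2,2⟩) ≥ 3m + 2` for `m ≥ 3` over any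
field (Alekseev 2015, Thm 1), `R(⟨5,2,2⟩) ≥ 17` (Alekseev 2014), `R(⟨2,2,n⟩) = ⌈7n/2⌉` over `GF(2)`
(Hopcroft–Kerr 1971; Alekseev–Nazarov 2019), `R_{GF(2)}(⟨2,3,3⟩) = 15`, `R_{GF(2)}(⟨2,3,4⟩) ≥ 19`
(Hopcroft–Kerr 1971; Wang 2026).

## References

* J. E. Hopcroft, L. R. Kerr, *On minimizing the number of multiplications necessary for matrix
  multiplication*, SIAM J. Appl. Math. 20 (1971) 30–36, abstract and §2. [HopcroftKerr1971]
* P. Bürgisser, M. Clausen, M. A. Shokrollahi, *Algebraic Complexity Theory* (1997), Thm. (17.12).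
  [BurgisserClausenShokrollahi1997]
* M. Bläser, J. Complexity 19 (2003) 43–60, eq. (1) p. 45. [Blaser2003]
* V. B. Alekseev, Chebyshevskiĭ Sb. 16 (4) (2015) 11–27, §1 and Thm 1. [Alekseev2015ChebyshevM22]
-/

namespace Literature.Computability.AlgebraicComplexity

universe u

section Upper

variable (K : Type u) [CommRing K]

/-- The induction behind `R(⟨2,3,n⟩) ≤ 5n`: glue `j` copies of `⟨2,3,3⟩:15` onto one of the bases
`⟨2,3,3⟩:15`, `⟨2,3,4⟩:20`, `⟨2,3,5⟩:25`. [cite: HopcroftKerr1971, abstract and §2 (case p = 3)] -/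
theorem tensorRank_matMulTensor_23_le_aux (j r : ℕ) (hr : r < 3) :
    tensorRank (matMulTensor K 2 3 (3 * j + 3 + r)) ≤ 5 * (3 * j + 3 + r) := by
  induction j with
  | zero =>
    interval_cases r
    · simpa using tensorRank_matMulTensor_233_le K
    · simpa using tensorRank_matMulTensor_234_le K
    · simpa using tensorRank_matMulTensor_235_le K
  | succ j ih =>
    have e : 3 * (j + 1) + 3 + r = (3 * j + 3 + r) + 3 := by ring
    rw [e]
    calc tensorRank (matMulTensor K 2 3 (3 * j + 3 + r + 3))
        ≤ tensorRank (matMulTensor K 2 3 (3 * j + 3 + r)) + tensorRank (matMulTensor K 2 3 3) :=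
          tensorRank_matMulTensor_add_right_le 2 3 (3 * j + 3 + r) 3
      _ ≤ 5 * (3 * j + 3 + r) + 15 := Nat.add_le_add ih (tensorRank_matMulTensor_233_le K)
      _ = 5 * (3 * j + 3 + r + 3) := by ring

/-- **Hopcroft–Kerr 1971 at `p = 3`**: `R(⟨2,3,n⟩) ≤ 5n` for every `n ≥ 3`, over every commutative
ring (`⌈(3·3·n + max(n,3))/2⌉ = 5n` for `n ≥ 3`). [cite: HopcroftKerr1971, abstract and §2 (case p = 3)] -/
theorem hopcroftKerr1971_tensorRank_matMulTensor_23n_le (n : ℕ) (hn : 3 ≤ n) :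
    tensorRank (matMulTensor K 2 3 n) ≤ 5 * n := by
  have e : n = 3 * ((n - 3) / 3) + 3 + (n - 3) % 3 := by omega
  rw [e]
  exact tensorRank_matMulTensor_23_le_aux K _ _ (Nat.mod_lt _ (by norm_num))

/-- **Hopcroft–Kerr 1971 at `p = 3`, printed format** (`3 × 2` by `2 × n`): `R(⟨3,2,n⟩) ≤ 5n` for
`n ≥ 3`, over every commutative ring. [cite: HopcroftKerr1971, abstract and §2 (case p = 3)] -/
theorem hopcroftKerr1971_tensorRank_matMulTensor_32n_le (n : ℕ) (hn : 3 ≤ n) :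
    tensorRank (matMulTensor K 3 2 n) ≤ 5 * n := by
  rw [← tensorRank_matMulTensor_rotate K n 3 2, ← tensorRank_matMulTensor_transpose K 2 3 n]
  exact hopcroftKerr1971_tensorRank_matMulTensor_23n_le K n hn

end Upper

section Lower

variable (k : Type u) [Field k]

/-- `3n + 1 ≤ R(⟨2,2,n⟩)` for `n ≥ 1` over every field (Lafon–Winograd / BCS Thm. (17.12) at
`(2,2,n)`; = Bläser 2003 eq. (1), "the lower bound `3m+1`" of Alekseev 2015 §1).
[cite: BurgisserClausenShokrollahi1997, Thm (17.12)] -/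
theorem three_mul_add_one_le_tensorRank_matMulTensor_22n (n : ℕ) (hn : 1 ≤ n) :
    3 * n + 1 ≤ tensorRank (matMulTensor k 2 2 n) := by
  have h := lafonWinograd_le_tensorRank_matMulTensor k (c := 2) (m := 2) (n := n) le_rfl
    (by norm_num) hn
  have e : 2 * 2 + 2 * (n - 1) + (n - 1) = 3 * n + 1 := by omega
  rw [e] at h
  exact h

/-- `4n + 2 ≤ R(⟨2,3,n⟩)` for `n ≥ 1` over every field (Lafon–Winograd / BCS Thm. (17.12) at
`(2,3,n)`; = Bläser 2003 eq. (1)). [cite: BurgisserClausenShokrollahi1997, Thm (17.12)] -/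
theorem four_mul_add_two_le_tensorRank_matMulTensor_23n (n : ℕ) (hn : 1 ≤ n) :
    4 * n + 2 ≤ tensorRank (matMulTensor k 2 3 n) := by
  have h := lafonWinograd_le_tensorRank_matMulTensor k (c := 2) (m := 3) (n := n) le_rfl
    (by norm_num) hn
  have e : 2 * 3 + 3 * (n - 1) + (n - 1) = 4 * n + 2 := by omega
  rw [e] at h
  exact h

/-- **The `⟨2,2,n⟩` sandwich over every field**: `3n + 1 ≤ R(⟨2,2,n⟩) ≤ ⌈7n/2⌉` (`n ≥ 1`;
lower: BCS Thm. (17.12) / Bläser 2003 (1); upper: Hopcroft–Kerr 1971).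
[cite: HopcroftKerr1971, abstract and §2 (case p = 2)] -/
theorem tensorRank_matMulTensor_22n_mem_Icc (n : ℕ) (hn : 1 ≤ n) :
    tensorRank (matMulTensor k 2 2 n) ∈ Set.Icc (3 * n + 1) ((7 * n + 1) / 2) :=
  ⟨three_mul_add_one_le_tensorRank_matMulTensor_22n k n hn,
    hopcroftKerr1971_tensorRank_matMulTensor_22n_le n⟩

/-- **The `⟨2,3,n⟩` sandwich over every field**: `4n + 2 ≤ R(⟨2,3,n⟩) ≤ 5n` (`n ≥ 3`;
lower: BCS Thm. (17.12) / Bläser 2003 (1); upper: Hopcroft–Kerr 1971).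
[cite: HopcroftKerr1971, abstract and §2 (case p = 3)] -/
theorem tensorRank_matMulTensor_23n_mem_Icc (n : ℕ) (hn : 3 ≤ n) :
    tensorRank (matMulTensor k 2 3 n) ∈ Set.Icc (4 * n + 2) (5 * n) :=
  ⟨four_mul_add_two_le_tensorRank_matMulTensor_23n k n (by omega),
    hopcroftKerr1971_tensorRank_matMulTensor_23n_le k n hn⟩

end Lower

end Literature.Computability.AlgebraicComplexity
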